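import Summits.ResolutionOfSingularities.ResolutionOfSingularities.Theorems.WeightedInvariantHypersurfaceLocalGameEFT4SDimLEDoorGradedHom
import Summits.ResolutionOfSingularities.ResolutionOfSingularities.Theorems.WeightedInvariantELadderTwoCompatible
import Summits.ResolutionOfSingularities.ResolutionOfSingularities.Theorems.WeightedInvariantELadderTwoStepAssembly
import Summits.ResolutionOfSingularities.ResolutionOfSingularities.Theorems.WeightedInvariantELadderTwoAtlasOverCentre
import Summits.ResolutionOfSingularities.ResolutionOfSingularities.Theorems.WeightedInvariantELadderTwoCentreOfHom

/-!
# `WeightedInvariant.HypersurfaceCentreConstruction` (stmt-ResolutionOfSingularities-19897), E2 tier: THE MILESTONE `AdmissiblyResolvableDim p 2`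
# FROM ITS NAMED LEAVES, IN THE TREE — graded HOM P3 rung + (G-6b) + the local drop word; the structured quotient step discharged by name

[OURS · route `ResolutionOfSingularities/WeightedInvariant` · DOOR crux `HypersurfaceCentreConstruction` (stmt-ResolutionOfSingularities-19897),
skeleton of record v3.12 `7a4b52ef4f5779aa` PART 6 (res-L1-w43-plan-1; registered E2 stubs `stub_e2_centre_h`, `stub_e2_inv_succ_loc_h`, P3 stub
`stub_keyRungGrHomLE_three`).  Candidates of the programme; nothing here is a statement of, or about, any manuscript under adjudication; AI-written,
weaker than expert review; counted 0; proves no summit and closes no registered stub — it PINS the E2 milestone to its open words in the kernel.]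

## What this file does (the skeleton's `e2_assembly`, re-run on the LANDED pieces with the open words as explicit hypotheses; no definition)

PART 6 of the skeleton reads `e2_assembly : KeyRungGrHomLE 3 p → AdmissiblyResolvableDim p 2` through `admissiblyResolvableDim_two_of_loc`
(res-D-pv-031, `…ELadderTwoCompatible`) fed with the three E2 stubs.  Since then: `stub_e2_step_h` is CLOSED by its statement
(`stub_e2_step_h_of_over (fun p _ => e2AtlasOverCentre p)`, `…ELadderTwoStepAssembly` + `…ELadderTwoAtlasOverCentre`), and `stub_e2_centre_h` rests
on the single word (G-6b) through `e2CentreH_of_hom` (`…ELadderTwoCentreOfHom`).  Hence: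

* `admissiblyResolvableDim_two_of_leaves` — **`AdmissiblyResolvableDim p 2` ⟸ `KeyRungGrHomLE 3 p` (registered `stub_keyRungGrHomLE_three`; clause
  census `keyRungGrHomLE_three_of_open_clauses`, `…KeyRungThreeOfClauses`) ∧ (G-6b) `∀ ι J, PRungGrHomLE 3 p ι J → E2HomogeneousChartBody p ι J →
  E2CentreHomBody p ι J` (RE-ENTRY OBJECT #2 of CHAIN w43 v4.39, target file `…ELadderTwoCentreHom`) ∧ the local drop word `∀ ι J, PRungGrHomLE 3 p ι J →
  E2InvSuccLocBody p ι J` (= registered `stub_e2_inv_succ_loc_h` at `p`; RE-ENTRY OBJECT #3, inputs = the six `…SuccessorRatioBound*` port files)**.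
The hypothesis list is the remaining-lemma census of the E2 tier.
-/

noncomputable section

set_option linter.dupNamespace false -- mandated namespace of this single-conjunct summit

open Literature.AlgebraicGeometry.Resolution
open Summit.ResolutionOfSingularities.ResolutionOfSingularities.Theorems

namespace Summit.ResolutionOfSingularities.ResolutionOfSingularities.Cruxes.HypersurfaceCentreConstruction.LocalEngine

namespace E2TierCensus

/-- **The E2 milestone from its named leaves** (module docstring): graded HOM P3 rung + (G-6b) + the local drop word ⇒ `AdmissiblyResolvableDim p 2`;
the step is `stub_e2_step_h_of_over (fun p _ => e2AtlasOverCentre p)` and the centre is `e2CentreH_of_hom`. [OURS · E2 tier kernel census] -/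
theorem admissiblyResolvableDim_two_of_leaves (p : ℕ) (hp : p.Prime) (hgr : KeyRungGrHomLE 3 p)
    (hhom : ∀ (ι : (R : Type) → [CommRing R] → R → Ordinal.{0}) (J : (R : Type) → [CommRing R] → R → ℕ → Ideal R),
      PRungGrHomLE 3 p ι J → E2HomogeneousChartBody p ι J → E2CentreHomBody p ι J)
    (hloc : ∀ (ι : (R : Type) → [CommRing R] → R → Ordinal.{0}) (J : (R : Type) → [CommRing R] → R → ℕ → Ideal R),
      PRungGrHomLE 3 p ι J → E2InvSuccLocBody p ι J) :
    Summit.ResolutionOfSingularities.ResolutionOfSingularities.Theorems.AdmissiblyResolvableDim p 2 := by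
  obtain ⟨ι, J, hPJ⟩ := hgr
  exact admissiblyResolvableDim_two_of_loc p ι J (e2CentreH_of_hom p hp ι J (hhom ι J) hPJ)
    (stub_e2_step_h_of_over (fun p _ => e2AtlasOverCentre p) p hp ι J hPJ) (hloc ι J hPJ)

/-- **The registrar's quantifier shape**: with (G-6b) and the local drop word for EVERY prime (as the registered stubs are typed), the graded HOM P3
rung at `p` gives the milestone at `p`. [OURS · E2 tier kernel census] -/
theorem admissiblyResolvableDim_two_of_rung
    (hhom : ∀ p : ℕ, p.Prime → ∀ (ι : (R : Type) → [CommRing R] → R → Ordinal.{0})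
      (J : (R : Type) → [CommRing R] → R → ℕ → Ideal R), PRungGrHomLE 3 p ι J → E2HomogeneousChartBody p ι J → E2CentreHomBody p ι J)
    (hloc : ∀ p : ℕ, p.Prime → ∀ (ι : (R : Type) → [CommRing R] → R → Ordinal.{0})
      (J : (R : Type) → [CommRing R] → R → ℕ → Ideal R), PRungGrHomLE 3 p ι J → E2InvSuccLocBody p ι J)
    (p : ℕ) (hp : p.Prime) (hgr : KeyRungGrHomLE 3 p) :
    Summit.ResolutionOfSingularities.ResolutionOfSingularities.Theorems.AdmissiblyResolvableDim p 2 :=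
  admissiblyResolvableDim_two_of_leaves p hp hgr (hhom p hp) (hloc p hp)

end E2TierCensus

end Summit.ResolutionOfSingularities.ResolutionOfSingularities.Cruxes.HypersurfaceCentreConstruction.LocalEngine

end
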